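/-
Copyright (c) 2026 the pub-hodgecm-mathlib formalisation cell (harness21).  Prover seat hodgecm-mathlib-K2Liu-p13 (g0), Track B «K2-LIT»,
#184♮ = hLiu418 = `stmt-HodgeConjecture-24832`; Road I v3 organ U1-CT-ind STAGE 2 (Q2), file F3″ (LEAD F0P6-plan (g13) 09:57:20Z «GO (Q2) F4 → F5 → D-U1 stage 3»).
-/
import Summits.HodgeConjecture.HodgeConjecture.Theorems.K2LiuDoubledAntidiagonalTransportLevi   -- ★ F3′: `deltaBlock_transport`, `map_smul_one`
import Literature.NumberTheory.GelbartRogawski1991.Prop311PrintedTransport                       -- ★ `mem_range_toAdelic_iff`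
import HarnessLib

/-!
# Crux `HLiu418`, Road I v3, organ U1 stage 2 (Q2), file F3″: THE TRANSPORT `Ψ` ON RATIONAL POINTS AND ON THE SIEGEL PARABOLIC —
# `Ψ g ∈ P_Δ(𝔸) ↔ g₂₁ = 0`, and `Ψ` maps `U(J_{2n})(L⁺)` onto `H(L⁺)`

Cell `hodgecm-mathlib`, crux item hLiu418 = `stmt-HodgeConjecture-24832`; squad K2 ∕ K2Liu; LEAD F0P6-plan (g13), co-dealer K2E5-plan (g7); prover K2Liu-p13 (g0).
THEOREMS ONLY (no `def`, no instance, no notation, no named-fact hypothesis, no `sorry`); lane `--supports stmt-HodgeConjecture-24832 --as helper` (count-neutral).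
Generic `n`; hypotheses = the clauses (T1), (T3) of ★ F3 `exists_antidiagonal_transport` BY VALUE, `φ := (algebraMap L 𝔸_L) ∘ (algebraMap L⁺ L)`.
* §1 the SECOND block-row sum of a transported element: `(blk Ψg)₂₁ + (blk Ψg)₂₂ = B₁₁ − (X.map φ)·B₂₁` (`rowSum₂_transport`; with ★ F3′ `deltaBlock_transport` =
  the first row sum `B₁₁ + (X.map φ)·B₂₁`), hence **`isSiegelDelta_transport_iff : Ψ g ∈ P_Δ(𝔸) ↔ B₂₁ = 0`** (⇐ clear; ⇒: `X B₂₁ = −X B₂₁`, multiply by `Y`,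
  `Y X = a·1`, and `a + a = 1` — no division by `2`).
* §2 RATIONAL POINTS: the generic lemma `mem_range_toAdelic_of_conj` («if `x ∈ U(J₁)(𝔸)` is rational and `y ∈ U(J₂)(𝔸)` has matrix `P·x·Q` with `P, Q` rational,
  `PQ = QP = 1`, then `y` is rational» — ★ `mem_range_toAdelic_iff`, `Matrix.map_injective` for `L ↪ 𝔸_L`, ★ `algebraMap_conj`), the matrices `SA = P.map ι`,
  `SA⁻¹ = Q.map ι` with `P, Q` over `L` (`SA_eq_map`, `SAinv_eq_map`, `P_mul_Q`, `Q_mul_P` from ★ `S_mul_S'`∕`S'_mul_S`), and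
  **`transport_mem_ratH` ∕ `transport_symm_mem_range`**: `Ψ` restricts to a bijection `U(J_{2n})(L⁺) ≃ H(L⁺)` — what the rational Bruhat cells of ★ F2 need to be
  read on `P_Δ(L⁺)\H(L⁺) = SiegelDeltaQuot` (file F4).
[GelbartRogawski1991 §3.1], [HarrisKudlaSweet1996 §1 (1.11)–(1.12)], [PlatonovRapinchuk1994 §2.3], [Mok2014 §1 Notation p. 5].
HONEST LABEL.  Count-neutral helper: `HC_CM` is proved only modulo the 7 printed citations (2 remaining named inputs: hLiu418 = `stmt-HodgeConjecture-24832`,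
h413 = `stmt-HodgeConjecture-24833`) until rung 0 closes.
-/

set_option autoImplicit false
set_option linter.dupNamespace false -- the mandated namespace repeats `HodgeConjecture.HodgeConjecture`

noncomputable section

open scoped Matrix
open NumberField IsDedekindDomain

namespace Summit.HodgeConjecture.HodgeConjecture.Cruxes.HLiu418.K2LiuDoubledAntidiagonalTransportRational

open Literature.NumberTheory.Automorphic Literature.NumberTheory.Automorphic.UnitaryGroup
open Literature.NumberTheory.GelbartRogawski1991 Literature.NumberTheory.GelbartRogawski1991.GRConstruction
open Literature.NumberTheory.GaloisRepresentations
open Literature.NumberTheory.K2Lit.SiegelDoubled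
open Summit.HodgeConjecture.HodgeConjecture.Cruxes.HLiu418.K2LiuSiegelDoubledIwasawaCompact (toBlocks₂₁_reindex_eq_zero_of_blockTriangular reindex_symm_mul_mul S_mul_S' S'_mul_S)
open Summit.HodgeConjecture.HodgeConjecture.Cruxes.HLiu418.K2LiuDoubledAntidiagonalTransportLevi (map_smul_one deltaBlock_transport)
open UnitaryDualPair

variable {L : Type} [Field L] [NumberField L] [IsCMField L]
variable {N M n : ℕ} {e : Fin N × Fin M ≃ Fin n}
  {dV : Fin N → L} {hdV : ∀ i, IsCMField.complexConj L (dV i) = dV i}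
  {dW : Fin M → L} {hdW : ∀ i, IsCMField.complexConj L (dW i) = dW i}

/-! ## §1 The second row sum and `Ψ g ∈ P_Δ(𝔸) ↔ g₂₁ = 0` -/

/-- **the second block-row sum of a transported element**: `(blk Ψg)₂₁ + (blk Ψg)₂₂ = B₁₁ − (X.map φ)·B₂₁`. [cite: HarrisKudlaSweet1996, §1 (1.11)–(1.12)] -/
theorem rowSum₂_transport {SA : GL (Fin (n + n)) (AdeleRing (𝓞 L) L)}
    {Ψ : (quasiSplit (Fp L) L (IsCMField.complexConj L) (n + n)).Adelic ≃ₜ* HA L e dV hdV dW hdW} {X Y : Matrix (Fin n) (Fin n) (Fp L)} {a : Fp L}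
    (hΨ : ∀ g : (quasiSplit (Fp L) L (IsCMField.complexConj L) (n + n)).Adelic,
      (((Ψ g : HA L e dV hdV dW hdW) : GL (Fin (n + n)) (AdeleRing (𝓞 L) L)) : Matrix (Fin (n + n)) (Fin (n + n)) (AdeleRing (𝓞 L) L)) =
        (SA : Matrix (Fin (n + n)) (Fin (n + n)) (AdeleRing (𝓞 L) L)) *
          ((adelicVal (Fp L) L (IsCMField.complexConj L) (n + n) _ g : GL (Fin (n + n)) (AdeleRing (𝓞 L) L)) :
            Matrix (Fin (n + n)) (Fin (n + n)) (AdeleRing (𝓞 L) L)) *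
          ((SA⁻¹ : GL (Fin (n + n)) (AdeleRing (𝓞 L) L)) : Matrix (Fin (n + n)) (Fin (n + n)) (AdeleRing (𝓞 L) L)))
    (ha : a + a = 1)
    (hSA : Matrix.reindex (e₂ (n := n)).symm (e₂ (n := n)).symm (SA : Matrix (Fin (n + n)) (Fin (n + n)) (AdeleRing (𝓞 L) L)) =
      Matrix.fromBlocks (1 : Matrix (Fin n) (Fin n) (AdeleRing (𝓞 L) L)) (X.map ((algebraMap L (AdeleRing (𝓞 L) L)).comp (algebraMap (Fp L) L))) 1
        (-(X.map ((algebraMap L (AdeleRing (𝓞 L) L)).comp (algebraMap (Fp L) L)))))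
    (hSAi : Matrix.reindex (e₂ (n := n)).symm (e₂ (n := n)).symm ((SA⁻¹ : GL (Fin (n + n)) (AdeleRing (𝓞 L) L)) : Matrix (Fin (n + n)) (Fin (n + n)) (AdeleRing (𝓞 L) L)) =
      Matrix.fromBlocks ((a • (1 : Matrix (Fin n) (Fin n) (Fp L))).map ((algebraMap L (AdeleRing (𝓞 L) L)).comp (algebraMap (Fp L) L)))
        ((a • (1 : Matrix (Fin n) (Fin n) (Fp L))).map ((algebraMap L (AdeleRing (𝓞 L) L)).comp (algebraMap (Fp L) L)))
        (Y.map ((algebraMap L (AdeleRing (𝓞 L) L)).comp (algebraMap (Fp L) L)))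
        (-(Y.map ((algebraMap L (AdeleRing (𝓞 L) L)).comp (algebraMap (Fp L) L)))))
    (g : (quasiSplit (Fp L) L (IsCMField.complexConj L) (n + n)).Adelic) :
    (blk L e dV hdV dW hdW (Ψ g)).toBlocks₂₁ + (blk L e dV hdV dW hdW (Ψ g)).toBlocks₂₂ =
      (Matrix.reindex (e₂ (n := n)).symm (e₂ (n := n)).symm ((adelicVal (Fp L) L (IsCMField.complexConj L) (n + n) _ g : GL (Fin (n + n)) (AdeleRing (𝓞 L) L)) :
            Matrix (Fin (n + n)) (Fin (n + n)) (AdeleRing (𝓞 L) L))).toBlocks₁₁ -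
        X.map ((algebraMap L (AdeleRing (𝓞 L) L)).comp (algebraMap (Fp L) L)) *
          (Matrix.reindex (e₂ (n := n)).symm (e₂ (n := n)).symm ((adelicVal (Fp L) L (IsCMField.complexConj L) (n + n) _ g : GL (Fin (n + n)) (AdeleRing (𝓞 L) L)) :
            Matrix (Fin (n + n)) (Fin (n + n)) (AdeleRing (𝓞 L) L))).toBlocks₂₁ := by
  dsimp only [blk]
  rw [hΨ g, reindex_symm_mul_mul, hSA, hSAi, map_smul_one]
  set B := Matrix.reindex (e₂ (n := n)).symm (e₂ (n := n)).symm ((adelicVal (Fp L) L (IsCMField.complexConj L) (n + n) _ g : GL (Fin (n + n)) (AdeleRing (𝓞 L) L)) :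
            Matrix (Fin (n + n)) (Fin (n + n)) (AdeleRing (𝓞 L) L)) with hB
  conv_lhs => rw [← Matrix.fromBlocks_toBlocks B]
  rw [Matrix.fromBlocks_multiply, Matrix.fromBlocks_multiply, Matrix.toBlocks_fromBlocks₂₁, Matrix.toBlocks_fromBlocks₂₂]
  simp only [Matrix.one_mul, Matrix.mul_smul, Matrix.mul_one, Matrix.mul_neg, Matrix.neg_mul]
  rw [show ∀ (P Q : Matrix (Fin n) (Fin n) (AdeleRing (𝓞 L) L)) (c : AdeleRing (𝓞 L) L), c • P + Q + (c • P + -Q) = c • P + c • P from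
      fun P Q c => by abel,
    ← add_smul, ← map_add, ha, map_one, one_smul, sub_eq_add_neg]

/-- **`Ψ g ∈ P_Δ(𝔸) ↔ B₂₁ = 0`** (the lower-left `e₂`-block of `adelicVal g` vanishes): ⇐ both row sums are `B₁₁`; ⇒ `X B₂₁ = −X B₂₁`, multiply by `Y` on the left
(`Y X = a·1`) and use `a + a = 1`. [cite: HarrisKudlaSweet1996, §1 (1.11)–(1.12)] [cite: GelbartRogawski1991, §3.1] -/
theorem isSiegelDelta_transport_iff {SA : GL (Fin (n + n)) (AdeleRing (𝓞 L) L)}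
    {Ψ : (quasiSplit (Fp L) L (IsCMField.complexConj L) (n + n)).Adelic ≃ₜ* HA L e dV hdV dW hdW} {X Y : Matrix (Fin n) (Fin n) (Fp L)} {a : Fp L}
    (hΨ : ∀ g : (quasiSplit (Fp L) L (IsCMField.complexConj L) (n + n)).Adelic,
      (((Ψ g : HA L e dV hdV dW hdW) : GL (Fin (n + n)) (AdeleRing (𝓞 L) L)) : Matrix (Fin (n + n)) (Fin (n + n)) (AdeleRing (𝓞 L) L)) =
        (SA : Matrix (Fin (n + n)) (Fin (n + n)) (AdeleRing (𝓞 L) L)) *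
          ((adelicVal (Fp L) L (IsCMField.complexConj L) (n + n) _ g : GL (Fin (n + n)) (AdeleRing (𝓞 L) L)) :
            Matrix (Fin (n + n)) (Fin (n + n)) (AdeleRing (𝓞 L) L)) *
          ((SA⁻¹ : GL (Fin (n + n)) (AdeleRing (𝓞 L) L)) : Matrix (Fin (n + n)) (Fin (n + n)) (AdeleRing (𝓞 L) L)))
    (ha : a + a = 1)
    (hSA : Matrix.reindex (e₂ (n := n)).symm (e₂ (n := n)).symm (SA : Matrix (Fin (n + n)) (Fin (n + n)) (AdeleRing (𝓞 L) L)) =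
      Matrix.fromBlocks (1 : Matrix (Fin n) (Fin n) (AdeleRing (𝓞 L) L)) (X.map ((algebraMap L (AdeleRing (𝓞 L) L)).comp (algebraMap (Fp L) L))) 1
        (-(X.map ((algebraMap L (AdeleRing (𝓞 L) L)).comp (algebraMap (Fp L) L)))))
    (hSAi : Matrix.reindex (e₂ (n := n)).symm (e₂ (n := n)).symm ((SA⁻¹ : GL (Fin (n + n)) (AdeleRing (𝓞 L) L)) : Matrix (Fin (n + n)) (Fin (n + n)) (AdeleRing (𝓞 L) L)) =
      Matrix.fromBlocks ((a • (1 : Matrix (Fin n) (Fin n) (Fp L))).map ((algebraMap L (AdeleRing (𝓞 L) L)).comp (algebraMap (Fp L) L)))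
        ((a • (1 : Matrix (Fin n) (Fin n) (Fp L))).map ((algebraMap L (AdeleRing (𝓞 L) L)).comp (algebraMap (Fp L) L)))
        (Y.map ((algebraMap L (AdeleRing (𝓞 L) L)).comp (algebraMap (Fp L) L)))
        (-(Y.map ((algebraMap L (AdeleRing (𝓞 L) L)).comp (algebraMap (Fp L) L)))))
    (hYX : Y * X = a • (1 : Matrix (Fin n) (Fin n) (Fp L)))
    (g : (quasiSplit (Fp L) L (IsCMField.complexConj L) (n + n)).Adelic) :
    IsSiegelDelta L e dV hdV dW hdW (Ψ g) ↔ (Matrix.reindex (e₂ (n := n)).symm (e₂ (n := n)).symm ((adelicVal (Fp L) L (IsCMField.complexConj L) (n + n) _ g : GL (Fin (n + n)) (AdeleRing (𝓞 L) L)) :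
            Matrix (Fin (n + n)) (Fin (n + n)) (AdeleRing (𝓞 L) L))).toBlocks₂₁ = 0 := by
  have h1 := deltaBlock_transport hΨ ha hSA hSAi g
  dsimp only [deltaBlock] at h1
  have h2 := rowSum₂_transport hΨ ha hSA hSAi g
  unfold IsSiegelDelta
  rw [h1, h2]
  set B := Matrix.reindex (e₂ (n := n)).symm (e₂ (n := n)).symm ((adelicVal (Fp L) L (IsCMField.complexConj L) (n + n) _ g : GL (Fin (n + n)) (AdeleRing (𝓞 L) L)) :
            Matrix (Fin (n + n)) (Fin (n + n)) (AdeleRing (𝓞 L) L)) with hB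
  set Xf := X.map ((algebraMap L (AdeleRing (𝓞 L) L)).comp (algebraMap (Fp L) L)) with hXf
  constructor
  · intro h
    have hP : Xf * B.toBlocks₂₁ + Xf * B.toBlocks₂₁ = 0 := by
      rw [← eq_neg_iff_add_eq_zero]
      exact add_left_cancel (h.trans (sub_eq_add_neg _ _))
    have hYX' : Y.map ((algebraMap L (AdeleRing (𝓞 L) L)).comp (algebraMap (Fp L) L)) * Xf =
        ((algebraMap L (AdeleRing (𝓞 L) L)).comp (algebraMap (Fp L) L)) a • (1 : Matrix (Fin n) (Fin n) (AdeleRing (𝓞 L) L)) := by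
      rw [hXf, ← Matrix.map_mul, hYX, map_smul_one]
    have h3 := congrArg (fun M => Y.map ((algebraMap L (AdeleRing (𝓞 L) L)).comp (algebraMap (Fp L) L)) * M) hP
    simp only [Matrix.mul_add, ← Matrix.mul_assoc, hYX', Matrix.smul_mul, Matrix.one_mul, Matrix.mul_zero] at h3
    rwa [← add_smul, ← map_add, ha, map_one, one_smul] at h3
  · intro h
    rw [h, Matrix.mul_zero, add_zero, sub_zero]

/-! ## §2 Rational points -/

/-- `((M.map ι).map (c ⊗ 1)) = (M.map c).map ι` for the diagonal embedding `ι : L → 𝔸_L` (★ `algebraMap_conj`). [cite: Mok2014, §1 Notation p. 5] -/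
theorem map_map_conjAdele {m : Type*} (A : Matrix m m L) :
    (A.map (algebraMap L (AdeleRing (𝓞 L) L))).map (conjAdele (Fp L) L (IsCMField.complexConj L)) =
      (A.map ((IsCMField.complexConj L : L ≃ₐ[Fp L] L) : L →+* L)).map (algebraMap L (AdeleRing (𝓞 L) L)) := by
  rw [Matrix.map_map, Matrix.map_map]
  congr 1
  funext x
  exact (algebraMap_conj (Fp L) L (IsCMField.complexConj L) x).symm

/-- **conjugates of rational points by rational matrices are rational**: if `x ∈ U(J₁)(𝔸_{L⁺})` is in the range of `toAdelic` and `y ∈ U(J₂)(𝔸_{L⁺})` has matrix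
`P·x·Q` with `P, Q` over `L`, `P Q = Q P = 1`, then `y` is in the range of `toAdelic`. [cite: PlatonovRapinchuk1994, §2.3] [cite: Mok2014, §1 Notation p. 5] -/
theorem mem_range_toAdelic_of_conj {N' : ℕ} {J₁ J₂ : Matrix (Fin N') (Fin N') L}
    (x : UnitaryGroup.adelic (Fp L) L (IsCMField.complexConj L) N' J₁)
    (hx : x ∈ (UnitaryGroup.toAdelic (Fp L) L (IsCMField.complexConj L) N' J₁).range)
    (P Q : Matrix (Fin N') (Fin N') L) (hPQ : P * Q = 1) (hQP : Q * P = 1)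
    (y : UnitaryGroup.adelic (Fp L) L (IsCMField.complexConj L) N' J₂)
    (hy : ((y : GL (Fin N') (AdeleRing (𝓞 L) L)) : Matrix (Fin N') (Fin N') (AdeleRing (𝓞 L) L)) =
      P.map (algebraMap L (AdeleRing (𝓞 L) L)) * ((x : GL (Fin N') (AdeleRing (𝓞 L) L)) : Matrix (Fin N') (Fin N') (AdeleRing (𝓞 L) L)) *
        Q.map (algebraMap L (AdeleRing (𝓞 L) L))) :
    y ∈ (UnitaryGroup.toAdelic (Fp L) L (IsCMField.complexConj L) N' J₂).range := by
  obtain ⟨γ, -, hγx⟩ := (Prop311.mem_range_toAdelic_iff (Fp L) L (IsCMField.complexConj L) J₁ x).1 hx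
  -- the rational matrix of `y` and its inverse
  have hyM : ((y : GL (Fin N') (AdeleRing (𝓞 L) L)) : Matrix (Fin N') (Fin N') (AdeleRing (𝓞 L) L)) =
      (P * (γ : Matrix (Fin N') (Fin N') L) * Q).map (algebraMap L (AdeleRing (𝓞 L) L)) := by
    rw [hy, ← hγx, Matrix.map_mul, Matrix.map_mul]
  have hinv1 : P * (γ : Matrix (Fin N') (Fin N') L) * Q * (P * ((γ⁻¹ : GL (Fin N') L) : Matrix (Fin N') (Fin N') L) * Q) = 1 := by
    calc P * (γ : Matrix (Fin N') (Fin N') L) * Q * (P * ((γ⁻¹ : GL (Fin N') L) : Matrix (Fin N') (Fin N') L) * Q)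
        = P * ((γ : Matrix (Fin N') (Fin N') L) * ((Q * P) * ((γ⁻¹ : GL (Fin N') L) : Matrix (Fin N') (Fin N') L))) * Q := by
          simp only [Matrix.mul_assoc]
      _ = 1 := by rw [hQP, Matrix.one_mul, ← Units.val_mul, mul_inv_cancel, Units.val_one, Matrix.mul_one, hPQ]
  have hinv2 : P * ((γ⁻¹ : GL (Fin N') L) : Matrix (Fin N') (Fin N') L) * Q * (P * (γ : Matrix (Fin N') (Fin N') L) * Q) = 1 := by
    calc P * ((γ⁻¹ : GL (Fin N') L) : Matrix (Fin N') (Fin N') L) * Q * (P * (γ : Matrix (Fin N') (Fin N') L) * Q)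
        = P * (((γ⁻¹ : GL (Fin N') L) : Matrix (Fin N') (Fin N') L) * ((Q * P) * (γ : Matrix (Fin N') (Fin N') L))) * Q := by
          simp only [Matrix.mul_assoc]
      _ = 1 := by rw [hQP, Matrix.one_mul, ← Units.val_mul, inv_mul_cancel, Units.val_one, Matrix.mul_one, hPQ]
  let γ' : GL (Fin N') L := ⟨P * (γ : Matrix (Fin N') (Fin N') L) * Q, P * ((γ⁻¹ : GL (Fin N') L) : Matrix (Fin N') (Fin N') L) * Q, hinv1, hinv2⟩
  have hγ'M : ((γ' : GL (Fin N') L) : Matrix (Fin N') (Fin N') L) = P * (γ : Matrix (Fin N') (Fin N') L) * Q := rfl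
  -- the unitarity of `y` descends to `γ'` along the injective `L ↪ 𝔸_L`
  have hy2 := mem_unitaryGroupOfForm_iff.1 y.2
  rw [UnitaryGroup.adelicForm, hyM, map_map_conjAdele, ← Matrix.transpose_map, ← Matrix.map_mul, ← Matrix.map_mul] at hy2
  have hγ'mem : γ' ∈ UnitaryGroup.rational (Fp L) L (IsCMField.complexConj L) N' J₂ := by
    rw [UnitaryGroup.rational, mem_unitaryGroupOfForm_iff, hγ'M]
    exact Matrix.map_injective (NumberField.AdeleRing.algebraMap_injective (𝓞 L) L) hy2
  exact (Prop311.mem_range_toAdelic_iff (Fp L) L (IsCMField.complexConj L) J₂ y).2 ⟨γ', hγ'mem, hyM.symm ▸ rfl⟩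

omit [IsCMField L] in
/-- `SA = ((1 X; 1 −X) reindexed).map φ` — a RATIONAL matrix read in `𝔸_L`. [cite: GelbartRogawski1991, §3.1] -/
theorem SA_eq_map {SA : GL (Fin (n + n)) (AdeleRing (𝓞 L) L)} {X : Matrix (Fin n) (Fin n) (Fp L)}
    (hSA : Matrix.reindex (e₂ (n := n)).symm (e₂ (n := n)).symm (SA : Matrix (Fin (n + n)) (Fin (n + n)) (AdeleRing (𝓞 L) L)) =
      Matrix.fromBlocks (1 : Matrix (Fin n) (Fin n) (AdeleRing (𝓞 L) L)) (X.map ((algebraMap L (AdeleRing (𝓞 L) L)).comp (algebraMap (Fp L) L))) 1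
        (-(X.map ((algebraMap L (AdeleRing (𝓞 L) L)).comp (algebraMap (Fp L) L))))) :
    (SA : Matrix (Fin (n + n)) (Fin (n + n)) (AdeleRing (𝓞 L) L)) =
      (Matrix.reindex (e₂ (n := n)) (e₂ (n := n)) (Matrix.fromBlocks (1 : Matrix (Fin n) (Fin n) (Fp L)) X 1 (-X))).map ((algebraMap L (AdeleRing (𝓞 L) L)).comp (algebraMap (Fp L) L)) := by
  have h := congrArg (Matrix.reindex (e₂ (n := n)) (e₂ (n := n))) hSA
  rw [Matrix.reindex_apply, Matrix.reindex_apply, Matrix.submatrix_submatrix, Equiv.symm_symm, Equiv.self_comp_symm, Matrix.submatrix_id_id] at h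
  rw [h, Matrix.reindex_apply, Matrix.reindex_apply, ← Matrix.submatrix_map, Matrix.fromBlocks_map,
    Matrix.map_neg _ (map_neg ((algebraMap L (AdeleRing (𝓞 L) L)).comp (algebraMap (Fp L) L))), Matrix.map_one _ (map_zero ((algebraMap L (AdeleRing (𝓞 L) L)).comp (algebraMap (Fp L) L))) (map_one ((algebraMap L (AdeleRing (𝓞 L) L)).comp (algebraMap (Fp L) L)))]

omit [IsCMField L] in
/-- `SA⁻¹ = ((a a; Y −Y) reindexed).map φ`. [cite: GelbartRogawski1991, §3.1] -/
theorem SAinv_eq_map {SA : GL (Fin (n + n)) (AdeleRing (𝓞 L) L)} {Y : Matrix (Fin n) (Fin n) (Fp L)} {a : Fp L}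
    (hSAi : Matrix.reindex (e₂ (n := n)).symm (e₂ (n := n)).symm ((SA⁻¹ : GL (Fin (n + n)) (AdeleRing (𝓞 L) L)) : Matrix (Fin (n + n)) (Fin (n + n)) (AdeleRing (𝓞 L) L)) =
      Matrix.fromBlocks ((a • (1 : Matrix (Fin n) (Fin n) (Fp L))).map ((algebraMap L (AdeleRing (𝓞 L) L)).comp (algebraMap (Fp L) L)))
        ((a • (1 : Matrix (Fin n) (Fin n) (Fp L))).map ((algebraMap L (AdeleRing (𝓞 L) L)).comp (algebraMap (Fp L) L)))
        (Y.map ((algebraMap L (AdeleRing (𝓞 L) L)).comp (algebraMap (Fp L) L)))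
        (-(Y.map ((algebraMap L (AdeleRing (𝓞 L) L)).comp (algebraMap (Fp L) L))))) :
    ((SA⁻¹ : GL (Fin (n + n)) (AdeleRing (𝓞 L) L)) : Matrix (Fin (n + n)) (Fin (n + n)) (AdeleRing (𝓞 L) L)) =
      (Matrix.reindex (e₂ (n := n)) (e₂ (n := n))
          (Matrix.fromBlocks (a • (1 : Matrix (Fin n) (Fin n) (Fp L))) (a • (1 : Matrix (Fin n) (Fin n) (Fp L))) Y (-Y))).map ((algebraMap L (AdeleRing (𝓞 L) L)).comp (algebraMap (Fp L) L)) := by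
  have h := congrArg (Matrix.reindex (e₂ (n := n)) (e₂ (n := n))) hSAi
  rw [Matrix.reindex_apply, Matrix.reindex_apply, Matrix.submatrix_submatrix, Equiv.symm_symm, Equiv.self_comp_symm, Matrix.submatrix_id_id] at h
  rw [h, Matrix.reindex_apply, Matrix.reindex_apply, ← Matrix.submatrix_map, Matrix.fromBlocks_map, Matrix.map_neg _ (map_neg ((algebraMap L (AdeleRing (𝓞 L) L)).comp (algebraMap (Fp L) L)))]

omit [NumberField L] [IsCMField L] in
/-- `P Q = 1` for the two rational frames (★ `S_mul_S'`). [cite: GelbartRogawski1991, §3.1] -/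
theorem P_mul_Q {X Y : Matrix (Fin n) (Fin n) (Fp L)} {a : Fp L} (ha : a + a = 1) (hXY : X * Y = a • (1 : Matrix (Fin n) (Fin n) (Fp L))) :
    (Matrix.reindex (e₂ (n := n)) (e₂ (n := n)) (Matrix.fromBlocks (1 : Matrix (Fin n) (Fin n) (Fp L)) X 1 (-X))).map (algebraMap (Fp L) L) *
        (Matrix.reindex (e₂ (n := n)) (e₂ (n := n))
          (Matrix.fromBlocks (a • (1 : Matrix (Fin n) (Fin n) (Fp L))) (a • (1 : Matrix (Fin n) (Fin n) (Fp L))) Y (-Y))).map (algebraMap (Fp L) L) = 1 := by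
  rw [← Matrix.map_mul, Matrix.reindex_apply, Matrix.reindex_apply, Matrix.submatrix_mul_equiv, S_mul_S' X Y a ha hXY, Matrix.submatrix_one_equiv,
    Matrix.map_one _ (map_zero _) (map_one _)]

omit [NumberField L] [IsCMField L] in
/-- `Q P = 1` for the two rational frames (★ `S'_mul_S`). [cite: GelbartRogawski1991, §3.1] -/
theorem Q_mul_P {X Y : Matrix (Fin n) (Fin n) (Fp L)} {a : Fp L} (ha : a + a = 1) (hYX : Y * X = a • (1 : Matrix (Fin n) (Fin n) (Fp L))) :
    (Matrix.reindex (e₂ (n := n)) (e₂ (n := n))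
          (Matrix.fromBlocks (a • (1 : Matrix (Fin n) (Fin n) (Fp L))) (a • (1 : Matrix (Fin n) (Fin n) (Fp L))) Y (-Y))).map (algebraMap (Fp L) L) *
        (Matrix.reindex (e₂ (n := n)) (e₂ (n := n)) (Matrix.fromBlocks (1 : Matrix (Fin n) (Fin n) (Fp L)) X 1 (-X))).map (algebraMap (Fp L) L) = 1 := by
  rw [← Matrix.map_mul, Matrix.reindex_apply, Matrix.reindex_apply, Matrix.submatrix_mul_equiv, S'_mul_S X Y a ha hYX, Matrix.submatrix_one_equiv,
    Matrix.map_one _ (map_zero _) (map_one _)]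

/-- **`Ψ` MAPS RATIONAL POINTS TO RATIONAL POINTS**: `g ∈ U(J_{2n})(L⁺) ⇒ Ψ g ∈ H(L⁺) = ratH`. [cite: GelbartRogawski1991, §3.1] [cite: PlatonovRapinchuk1994, §2.3] -/
theorem transport_mem_ratH {SA : GL (Fin (n + n)) (AdeleRing (𝓞 L) L)}
    {Ψ : (quasiSplit (Fp L) L (IsCMField.complexConj L) (n + n)).Adelic ≃ₜ* HA L e dV hdV dW hdW} {X Y : Matrix (Fin n) (Fin n) (Fp L)} {a : Fp L}
    (hΨ : ∀ g : (quasiSplit (Fp L) L (IsCMField.complexConj L) (n + n)).Adelic,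
      (((Ψ g : HA L e dV hdV dW hdW) : GL (Fin (n + n)) (AdeleRing (𝓞 L) L)) : Matrix (Fin (n + n)) (Fin (n + n)) (AdeleRing (𝓞 L) L)) =
        (SA : Matrix (Fin (n + n)) (Fin (n + n)) (AdeleRing (𝓞 L) L)) *
          ((adelicVal (Fp L) L (IsCMField.complexConj L) (n + n) _ g : GL (Fin (n + n)) (AdeleRing (𝓞 L) L)) :
            Matrix (Fin (n + n)) (Fin (n + n)) (AdeleRing (𝓞 L) L)) *
          ((SA⁻¹ : GL (Fin (n + n)) (AdeleRing (𝓞 L) L)) : Matrix (Fin (n + n)) (Fin (n + n)) (AdeleRing (𝓞 L) L)))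
    (ha : a + a = 1)
    (hSA : Matrix.reindex (e₂ (n := n)).symm (e₂ (n := n)).symm (SA : Matrix (Fin (n + n)) (Fin (n + n)) (AdeleRing (𝓞 L) L)) =
      Matrix.fromBlocks (1 : Matrix (Fin n) (Fin n) (AdeleRing (𝓞 L) L)) (X.map ((algebraMap L (AdeleRing (𝓞 L) L)).comp (algebraMap (Fp L) L))) 1
        (-(X.map ((algebraMap L (AdeleRing (𝓞 L) L)).comp (algebraMap (Fp L) L)))))
    (hSAi : Matrix.reindex (e₂ (n := n)).symm (e₂ (n := n)).symm ((SA⁻¹ : GL (Fin (n + n)) (AdeleRing (𝓞 L) L)) : Matrix (Fin (n + n)) (Fin (n + n)) (AdeleRing (𝓞 L) L)) =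
      Matrix.fromBlocks ((a • (1 : Matrix (Fin n) (Fin n) (Fp L))).map ((algebraMap L (AdeleRing (𝓞 L) L)).comp (algebraMap (Fp L) L)))
        ((a • (1 : Matrix (Fin n) (Fin n) (Fp L))).map ((algebraMap L (AdeleRing (𝓞 L) L)).comp (algebraMap (Fp L) L)))
        (Y.map ((algebraMap L (AdeleRing (𝓞 L) L)).comp (algebraMap (Fp L) L)))
        (-(Y.map ((algebraMap L (AdeleRing (𝓞 L) L)).comp (algebraMap (Fp L) L)))))
    (hXY : X * Y = a • (1 : Matrix (Fin n) (Fin n) (Fp L))) (hYX : Y * X = a • (1 : Matrix (Fin n) (Fin n) (Fp L)))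
    {g : (quasiSplit (Fp L) L (IsCMField.complexConj L) (n + n)).Adelic}
    (hg : g ∈ (UnitaryGroup.toAdelic (Fp L) L (IsCMField.complexConj L) (n + n) ((StdForm.antidiagonal (n + n)).over L)).range) :
    Ψ g ∈ ratH L e dV hdV dW hdW := by
  refine mem_range_toAdelic_of_conj g hg _ _ (P_mul_Q ha hXY) (Q_mul_P ha hYX) (Ψ g : HA L e dV hdV dW hdW) ?_
  rw [hΨ g, SA_eq_map hSA, SAinv_eq_map hSAi, adelicVal_apply, RingHom.coe_comp, ← Matrix.map_map, ← Matrix.map_map]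

/-- **… AND ONTO**: `Ψ⁻¹ h ∈ U(J_{2n})(L⁺)` for `h ∈ H(L⁺)` (the matrix of `Ψ⁻¹ h` is `SA⁻¹·h·SA`). [cite: GelbartRogawski1991, §3.1] [cite: PlatonovRapinchuk1994, §2.3] -/
theorem transport_symm_mem_range {SA : GL (Fin (n + n)) (AdeleRing (𝓞 L) L)}
    {Ψ : (quasiSplit (Fp L) L (IsCMField.complexConj L) (n + n)).Adelic ≃ₜ* HA L e dV hdV dW hdW} {X Y : Matrix (Fin n) (Fin n) (Fp L)} {a : Fp L}
    (hΨ : ∀ g : (quasiSplit (Fp L) L (IsCMField.complexConj L) (n + n)).Adelic,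
      (((Ψ g : HA L e dV hdV dW hdW) : GL (Fin (n + n)) (AdeleRing (𝓞 L) L)) : Matrix (Fin (n + n)) (Fin (n + n)) (AdeleRing (𝓞 L) L)) =
        (SA : Matrix (Fin (n + n)) (Fin (n + n)) (AdeleRing (𝓞 L) L)) *
          ((adelicVal (Fp L) L (IsCMField.complexConj L) (n + n) _ g : GL (Fin (n + n)) (AdeleRing (𝓞 L) L)) :
            Matrix (Fin (n + n)) (Fin (n + n)) (AdeleRing (𝓞 L) L)) *
          ((SA⁻¹ : GL (Fin (n + n)) (AdeleRing (𝓞 L) L)) : Matrix (Fin (n + n)) (Fin (n + n)) (AdeleRing (𝓞 L) L)))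
    (ha : a + a = 1)
    (hSA : Matrix.reindex (e₂ (n := n)).symm (e₂ (n := n)).symm (SA : Matrix (Fin (n + n)) (Fin (n + n)) (AdeleRing (𝓞 L) L)) =
      Matrix.fromBlocks (1 : Matrix (Fin n) (Fin n) (AdeleRing (𝓞 L) L)) (X.map ((algebraMap L (AdeleRing (𝓞 L) L)).comp (algebraMap (Fp L) L))) 1
        (-(X.map ((algebraMap L (AdeleRing (𝓞 L) L)).comp (algebraMap (Fp L) L)))))
    (hSAi : Matrix.reindex (e₂ (n := n)).symm (e₂ (n := n)).symm ((SA⁻¹ : GL (Fin (n + n)) (AdeleRing (𝓞 L) L)) : Matrix (Fin (n + n)) (Fin (n + n)) (AdeleRing (𝓞 L) L)) =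
      Matrix.fromBlocks ((a • (1 : Matrix (Fin n) (Fin n) (Fp L))).map ((algebraMap L (AdeleRing (𝓞 L) L)).comp (algebraMap (Fp L) L)))
        ((a • (1 : Matrix (Fin n) (Fin n) (Fp L))).map ((algebraMap L (AdeleRing (𝓞 L) L)).comp (algebraMap (Fp L) L)))
        (Y.map ((algebraMap L (AdeleRing (𝓞 L) L)).comp (algebraMap (Fp L) L)))
        (-(Y.map ((algebraMap L (AdeleRing (𝓞 L) L)).comp (algebraMap (Fp L) L)))))
    (hXY : X * Y = a • (1 : Matrix (Fin n) (Fin n) (Fp L))) (hYX : Y * X = a • (1 : Matrix (Fin n) (Fin n) (Fp L)))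
    {h : HA L e dV hdV dW hdW} (hh : h ∈ ratH L e dV hdV dW hdW) :
    Ψ.symm h ∈ (UnitaryGroup.toAdelic (Fp L) L (IsCMField.complexConj L) (n + n) ((StdForm.antidiagonal (n + n)).over L)).range := by
  refine mem_range_toAdelic_of_conj (h : HA L e dV hdV dW hdW) hh _ _ (Q_mul_P ha hYX) (P_mul_Q ha hXY) (Ψ.symm h) ?_
  -- from (T1) at `g := Ψ⁻¹ h`: `h = SA · (Ψ⁻¹ h) · SA⁻¹` in `GL`, so `(Ψ⁻¹ h) = SA⁻¹ · h · SA`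
  have h1 := hΨ (Ψ.symm h)
  rw [ContinuousMulEquiv.apply_symm_apply] at h1
  have hGL : adelicVal (Fp L) L (IsCMField.complexConj L) (n + n) _ (Ψ.symm h) =
      SA⁻¹ * ((h : HA L e dV hdV dW hdW) : GL (Fin (n + n)) (AdeleRing (𝓞 L) L)) * SA := by
    have h1' : ((h : HA L e dV hdV dW hdW) : GL (Fin (n + n)) (AdeleRing (𝓞 L) L)) =
        SA * adelicVal (Fp L) L (IsCMField.complexConj L) (n + n) _ (Ψ.symm h) * SA⁻¹ := Units.ext h1
    rw [h1']
    group
  rw [← adelicVal_apply (Fp L) L (IsCMField.complexConj L) (n + n) ((StdForm.antidiagonal (n + n)).over L) (Ψ.symm h), hGL, Units.val_mul,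
    Units.val_mul, SA_eq_map hSA, SAinv_eq_map hSAi, RingHom.coe_comp, ← Matrix.map_map, ← Matrix.map_map]

end Summit.HodgeConjecture.HodgeConjecture.Cruxes.HLiu418.K2LiuDoubledAntidiagonalTransportRational

end
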